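import Summits.Ventures.PercRepro.C041CycleHost
import Summits.Ventures.PercRepro.C041TwoExitSix
import Summits.Ventures.PercRepro.C041CycleArcModel

/-!
# ROW C-041 — THE STATUSES OF A COLOURING OF THE CYCLE BY ITS ARC TYPES, and the count of colourings of each
type (p6, gen 31; towards the dictionary with mine-3's arc-type model, C-041.md §21 (a))

The cycle `cyc n` with the anchor `0` and the exits `i < j` (both `≠ 0`) splits into the arcs `A₁ = [0, i)`,
`A₂ = [i, j)`, `A₃ = [j, n]` (as sets of edges, all non-empty).  By the reach lemma of `C041CycleHost` the
statuses of a colouring `ω` are read off the arcs (`Mg_cyc_exit₁` … `Mg_cyc_exits`): `x_i` is merged iff `A₁` is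
blue or `A₂`, `A₃` are; reached iff `A₁` is red or `A₂`, `A₃` are; `x_j` alike with `A₁ ↔ A₃`; the exits are
blue-connected iff `A₂` is blue or `A₁`, `A₃` are.  The TYPE of an arc is its code `0` (all blue), `1` (all red),
`2` (mixed) (`code`), and the contribution `contrib` of the statuses is mine-3's table `cycCol` at the three
types (`contrib_arc`, the 27 cases; `arcOf` decodes).  The colourings of the cycle with prescribed types are
counted (`card_code_eq`): `1`, `1` or `2^ℓ − 2` per arc of length `ℓ`, multiplied — the colourings are the
triples of their restrictions to the arcs (`arcsEquiv`).
-/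

namespace PercRepro

namespace ZoneZ

namespace TwoExit

open ZoneData Pendant TreeClosure RelaxedTriangle Finset

/-! ## The 27 cases: the contribution of the statuses is mine-3's table -/

/-- The arc type of a code: `0 ↦ b`, `1 ↦ r`, `2 ↦ x`. -/
def arcOf : Fin 3 → Arc
  | 0 => .b
  | 1 => .r
  | 2 => .x

/-- **The contribution of the statuses of an arc-type triple is mine-3's `cycCol`** (statuses: `x_i` merged iff
`A₁` blue or `A₂`, `A₃` blue; reached iff `A₁` red or `A₂`, `A₃` red; `x_j` alike with `A₁ ↔ A₃`; blue-connected
iff `A₂` blue or `A₁`, `A₃` blue). -/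
theorem contrib_arc (w w' : Vec6) (t₁ t₂ t₃ : Fin 3) :
    contrib w w' (t₁ = 0 ∨ (t₂ = 0 ∧ t₃ = 0)) (t₁ = 1 ∨ (t₂ = 1 ∧ t₃ = 1)) (t₃ = 0 ∨ (t₁ = 0 ∧ t₂ = 0))
      (t₃ = 1 ∨ (t₁ = 1 ∧ t₂ = 1)) (t₂ = 0 ∨ (t₁ = 0 ∧ t₃ = 0)) = cycCol w w' (arcOf t₁) (arcOf t₂) (arcOf t₃) := by
  fin_cases t₁ <;> fin_cases t₂ <;> fin_cases t₃ <;>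
    simp only [contrib, exitOf, cycCol, arcOf, Fin.isValue, Fin.zero_eta, Fin.mk_one, Fin.reduceFinMk, Fin.reduceEq,
      one_ne_zero, zero_ne_one, or_true, or_false, and_self, and_true, and_false, ite_true, ite_false] <;>
    first
      | rfl
      | (funext i; fin_cases i <;> simp [thR, thB, nAdm, kInv])

/-! ## Arcs, monochromatic arcs, codes -/

variable (n : ℕ)

/-- Every edge of the arc `A` has the colour `c`. -/
def allc (A : Fin (n + 1) → Prop) (c : Bool) (ω : Fin (n + 1) → Bool) : Prop := ∀ k, A k → ω k = c

open Classical in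
/-- The type of the arc `A` under `ω`: `0` all blue, `1` all red, `2` mixed. -/
noncomputable def code (A : Fin (n + 1) → Prop) (ω : Fin (n + 1) → Bool) : Fin 3 :=
  if allc n A false ω then 0 else if allc n A true ω then 1 else 2

/-- A non-empty arc is not both all blue and all red. -/
theorem not_allc_both {A : Fin (n + 1) → Prop} (hA : ∃ k, A k) (ω : Fin (n + 1) → Bool)
    (h0 : allc n A false ω) (h1 : allc n A true ω) : False := by
  obtain ⟨k, hk⟩ := hA
  have := (h0 k hk).symm.trans (h1 k hk)
  exact Bool.false_ne_true this

/-- The code is `0` iff the arc is all blue. -/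
theorem code_eq_zero_iff {A : Fin (n + 1) → Prop} (ω : Fin (n + 1) → Bool) :
    code n A ω = 0 ↔ allc n A false ω := by
  unfold code
  by_cases h0 : allc n A false ω
  · simp [h0]
  · by_cases h1 : allc n A true ω <;> simp [h0, h1]

/-- The code is `1` iff the arc (non-empty) is all red. -/
theorem code_eq_one_iff {A : Fin (n + 1) → Prop} (hA : ∃ k, A k) (ω : Fin (n + 1) → Bool) :
    code n A ω = 1 ↔ allc n A true ω := by
  unfold code
  by_cases h0 : allc n A false ω
  · simp only [h0, if_true, Fin.isValue, zero_ne_one, false_iff]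
    exact fun h1 => not_allc_both n hA ω h0 h1
  · by_cases h1 : allc n A true ω <;> simp [h0, h1]

/-! ## The three arcs of the cycle with exits `i < j` -/

variable (i j : Fin (n + 1))

/-- The first arc `[0, i)`. -/
def arc₁ (k : Fin (n + 1)) : Prop := k.val < i.val
/-- The middle arc `[i, j)`. -/
def arc₂ (k : Fin (n + 1)) : Prop := i.val ≤ k.val ∧ k.val < j.val
/-- The last arc `[j, n]`. -/
def arc₃ (k : Fin (n + 1)) : Prop := j.val ≤ k.val

variable (c : Bool) (ω : Fin (n + 1) → Bool)

/-- `[i, n]` is the union of the last two arcs. -/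
theorem allc_ge_iff (hij : i.val ≤ j.val) :
    (∀ k : Fin (n + 1), i.val ≤ k.val → ω k = c) ↔ allc n (arc₂ n i j) c ω ∧ allc n (arc₃ n j) c ω := by
  unfold allc arc₂ arc₃
  constructor
  · intro h
    exact ⟨fun k hk => h k hk.1, fun k hk => h k (by omega)⟩
  · rintro ⟨h2, h3⟩ k hk
    by_cases hkj : k.val < j.val
    · exact h2 k ⟨hk, hkj⟩
    · exact h3 k (by omega)

/-- `[0, j)` is the union of the first two arcs. -/
theorem allc_lt_iff (hij : i.val ≤ j.val) :
    (∀ k : Fin (n + 1), k.val < j.val → ω k = c) ↔ allc n (arc₁ n i) c ω ∧ allc n (arc₂ n i j) c ω := by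
  unfold allc arc₁ arc₂
  constructor
  · intro h
    exact ⟨fun k hk => h k (by omega), fun k hk => h k hk.2⟩
  · rintro ⟨h1, h2⟩ k hk
    by_cases hki : k.val < i.val
    · exact h1 k hki
    · exact h2 k ⟨by omega, hk⟩

/-- The complement of the middle arc is the union of the outer arcs. -/
theorem allc_outer_iff :
    (∀ k : Fin (n + 1), k.val < i.val ∨ j.val ≤ k.val → ω k = c) ↔ allc n (arc₁ n i) c ω ∧ allc n (arc₃ n j) c ω := by
  unfold allc arc₁ arc₃
  constructor
  · intro h
    exact ⟨fun k hk => h k (Or.inl hk), fun k hk => h k (Or.inr hk)⟩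
  · rintro ⟨h1, h3⟩ k hk
    rcases hk with hk | hk
    · exact h1 k hk
    · exact h3 k hk

/-- The statuses of the first exit, reached along the colour `c` from the anchor `0`. -/
theorem mem_reach_cyc_zero (z : Fin (n + 1)) :
    z ∈ reach (cAdj (cyc n) c ω) {0} ↔
      (∀ k : Fin (n + 1), k.val < z.val → ω k = c) ∨ (∀ k : Fin (n + 1), z.val ≤ k.val → ω k = c) := by
  rw [mem_reach_cyc]
  unfold fwdArc bwdArc
  simp only [Fin.val_zero, Nat.zero_le, if_true, true_and, Nat.not_lt_zero, false_or]

/-- **`x_i` is merged** iff `A₁` is blue or `A₂`, `A₃` are. -/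
theorem Mg_cyc_exit₁ (hij : i.val ≤ j.val) :
    (cyc n).Mg 0 i ω ↔ allc n (arc₁ n i) false ω ∨ (allc n (arc₂ n i j) false ω ∧ allc n (arc₃ n j) false ω) := by
  unfold Mg
  rw [← Pendant.cAdj_false, mem_reach_cyc_zero, allc_ge_iff n i j false ω hij]
  rfl

/-- **`x_i` is reached** iff `A₁` is red or `A₂`, `A₃` are. -/
theorem Rd_cyc_exit₁ (hij : i.val ≤ j.val) :
    (cyc n).Rd 0 i ω ↔ allc n (arc₁ n i) true ω ∨ (allc n (arc₂ n i j) true ω ∧ allc n (arc₃ n j) true ω) := by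
  unfold Rd
  rw [← Pendant.cAdj_true, mem_reach_cyc_zero, allc_ge_iff n i j true ω hij]
  rfl

/-- **`x_j` is merged** iff `A₃` is blue or `A₁`, `A₂` are. -/
theorem Mg_cyc_exit₂ (hij : i.val ≤ j.val) :
    (cyc n).Mg 0 j ω ↔ allc n (arc₃ n j) false ω ∨ (allc n (arc₁ n i) false ω ∧ allc n (arc₂ n i j) false ω) := by
  unfold Mg
  rw [← Pendant.cAdj_false, mem_reach_cyc_zero, allc_lt_iff n i j false ω hij, or_comm]
  rfl

/-- **`x_j` is reached** iff `A₃` is red or `A₁`, `A₂` are. -/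
theorem Rd_cyc_exit₂ (hij : i.val ≤ j.val) :
    (cyc n).Rd 0 j ω ↔ allc n (arc₃ n j) true ω ∨ (allc n (arc₁ n i) true ω ∧ allc n (arc₂ n i j) true ω) := by
  unfold Rd
  rw [← Pendant.cAdj_true, mem_reach_cyc_zero, allc_lt_iff n i j true ω hij, or_comm]
  rfl

/-- **The exits are blue-connected** iff `A₂` is blue or `A₁`, `A₃` are. -/
theorem Mg_cyc_exits (hij : i.val ≤ j.val) :
    (cyc n).Mg i j ω ↔ allc n (arc₂ n i j) false ω ∨ (allc n (arc₁ n i) false ω ∧ allc n (arc₃ n j) false ω) := by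
  unfold Mg
  rw [← Pendant.cAdj_false, mem_reach_cyc, ← allc_outer_iff]
  unfold fwdArc bwdArc
  simp only [if_pos hij]
  rfl

/-- The statuses, through the codes of the three arcs (all arcs non-empty: `0 < i < j`). -/
theorem contrib_cyc (hi : 0 < i.val) (hij : i.val < j.val) (w w' : Vec6) :
    contrib w w' ((cyc n).Mg 0 i ω) ((cyc n).Rd 0 i ω) ((cyc n).Mg 0 j ω) ((cyc n).Rd 0 j ω) ((cyc n).Mg i j ω) =
      cycCol w w' (arcOf (code n (arc₁ n i) ω)) (arcOf (code n (arc₂ n i j) ω)) (arcOf (code n (arc₃ n j) ω)) := by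
  have h1 : ∃ k, arc₁ n i k := ⟨0, by unfold arc₁; simp only [Fin.val_zero]; exact hi⟩
  have h2 : ∃ k, arc₂ n i j k := ⟨i, by unfold arc₂; exact ⟨le_rfl, hij⟩⟩
  have h3 : ∃ k, arc₃ n j k := ⟨j, by unfold arc₃; exact le_rfl⟩
  rw [← contrib_arc w w' (code n (arc₁ n i) ω) (code n (arc₂ n i j) ω) (code n (arc₃ n j) ω)]
  rw [code_eq_zero_iff, code_eq_zero_iff, code_eq_zero_iff, code_eq_one_iff n h1, code_eq_one_iff n h2,
    code_eq_one_iff n h3, Mg_cyc_exit₁ n i j ω hij.le, Rd_cyc_exit₁ n i j ω hij.le, Mg_cyc_exit₂ n i j ω hij.le,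
    Rd_cyc_exit₂ n i j ω hij.le, Mg_cyc_exits n i j ω hij.le]

end TwoExit

end ZoneZ

end PercRepro
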